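import Summits.AtomisticToContinuum.HydrodynamicLimit.Theorems.ImplosionDichotomyPolynomialCompressionTorusJetCalculus

/-!
# Torus jets I: exact Leibniz, chain, inverse and power rules of orders 2 and 3 on `𝕋³`

Helper file for the line `log-lipschitz-budget` of the crux `ImplosionDichotomy.PolynomialCompression`
(stmt-AtomisticToContinuum-12587), stub `stub_logBudgetShadowing`, levels 2–3 of the `H³` energy
method (see `…TorusJetCalculus` for the setting and the first-order rules). This file iterates the
first-order rules to the exact pointwise identities of orders 2 and 3,
`torusJet_<op>_deriv2/3` for `op ∈ {const, add, sub, neg, const_mul, sum, mul, comp (two forms),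
inv, rpow}`:

* Leibniz with 4 resp. 8 terms (`torusJet_mul_deriv2/3`);
* Faà di Bruno for `φ ∘ f` (`torusJet_comp_deriv2/3(_of_hasDerivAt)`):
  `∂ᵢ∂ⱼ(φ∘f) = φ''(f) ∂ᵢf ∂ⱼf + φ'(f) ∂ᵢ∂ⱼf`,
  `∂ᵢ∂ⱼ∂ₖ(φ∘f) = φ'''(f) ∂ᵢf ∂ⱼf ∂ₖf + φ''(f) (∂ᵢ∂ⱼf ∂ₖf + ∂ᵢ∂ₖf ∂ⱼf + ∂ⱼ∂ₖf ∂ᵢf) + φ'(f) ∂ᵢ∂ⱼ∂ₖf`;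
* the specialisations `r ↦ r⁻¹` (`f ≠ 0`) and `r ↦ r ^ p` (`f > 0`) with explicit coefficients.

Second derivatives are always the nested `Torus.partialDeriv i (Torus.partialDeriv j f) x`, third
ones `Torus.partialDeriv i (Torus.partialDeriv j (Torus.partialDeriv k f)) x` (no symmetrisation is
used or needed). Proofs: order `n + 1` rewrites the innermost derivative by the order-1 identity
(as an identity of functions, all fields being smooth) and applies the order-`n` identity to the
result, or differentiates the order-`n` polynomial expression once more along a coordinate line
(`torusJet_hasDerivAt_coordLine(_comp)`), closing by `ring`.
-/

noncomputable section

namespace Summit.AtomisticToContinuum.HydrodynamicLimit.Theorems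

open Set Filter Topology MeasureTheory
open scoped ContDiff
open Literature.MathematicalPhysics.KineticTheory Literature.Analysis.FunctionSpaces

section TorusJetIdentities

/-! ### Order 2 -/

/-- `∂ᵢ∂ⱼ c = 0`. [folklore] -/
theorem torusJet_const_deriv2 : ∀ (c : ℝ) (i j : Fin 3) (x : T3),
    Torus.partialDeriv i (Torus.partialDeriv j (fun _ : T3 => c)) x = 0 := by
  intro c i j x
  rw [show Torus.partialDeriv j (fun _ : T3 => c) = fun _ => (0 : ℝ) from
    funext fun y => torusJet_const_deriv1 c j y]
  exact torusJet_const_deriv1 0 i x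

/-- `∂ᵢ∂ⱼ(f + g) = ∂ᵢ∂ⱼf + ∂ᵢ∂ⱼg`. [folklore] -/
theorem torusJet_add_deriv2 : ∀ {f g : T3 → ℝ}, Torus.IsSmooth f → Torus.IsSmooth g →
    ∀ (i j : Fin 3) (x : T3),
    Torus.partialDeriv i (Torus.partialDeriv j (fun y => f y + g y)) x =
      Torus.partialDeriv i (Torus.partialDeriv j f) x + Torus.partialDeriv i (Torus.partialDeriv j g) x := by
  intro f g hf hg i j x
  rw [show Torus.partialDeriv j (fun y => f y + g y) =
      fun y => Torus.partialDeriv j f y + Torus.partialDeriv j g y from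
    funext fun y => torusJet_add_deriv1 hf hg j y]
  exact torusJet_add_deriv1 (hf.partialDeriv j) (hg.partialDeriv j) i x

/-- `∂ᵢ∂ⱼ(f - g) = ∂ᵢ∂ⱼf - ∂ᵢ∂ⱼg`. [folklore] -/
theorem torusJet_sub_deriv2 : ∀ {f g : T3 → ℝ}, Torus.IsSmooth f → Torus.IsSmooth g →
    ∀ (i j : Fin 3) (x : T3),
    Torus.partialDeriv i (Torus.partialDeriv j (fun y => f y - g y)) x =
      Torus.partialDeriv i (Torus.partialDeriv j f) x - Torus.partialDeriv i (Torus.partialDeriv j g) x := by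
  intro f g hf hg i j x
  rw [show Torus.partialDeriv j (fun y => f y - g y) =
      fun y => Torus.partialDeriv j f y - Torus.partialDeriv j g y from
    funext fun y => torusJet_sub_deriv1 hf hg j y]
  exact torusJet_sub_deriv1 (hf.partialDeriv j) (hg.partialDeriv j) i x

/-- `∂ᵢ∂ⱼ(-f) = -∂ᵢ∂ⱼf`. [folklore] -/
theorem torusJet_neg_deriv2 : ∀ {f : T3 → ℝ}, Torus.IsSmooth f → ∀ (i j : Fin 3) (x : T3),
    Torus.partialDeriv i (Torus.partialDeriv j (fun y => -f y)) x =
      -Torus.partialDeriv i (Torus.partialDeriv j f) x := by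
  intro f hf i j x
  rw [show Torus.partialDeriv j (fun y => -f y) = fun y => -Torus.partialDeriv j f y from
    funext fun y => torusJet_neg_deriv1 hf j y]
  exact torusJet_neg_deriv1 (hf.partialDeriv j) i x

/-- `∂ᵢ∂ⱼ(c f) = c ∂ᵢ∂ⱼf`. [folklore] -/
theorem torusJet_const_mul_deriv2 : ∀ {f : T3 → ℝ}, Torus.IsSmooth f → ∀ (c : ℝ) (i j : Fin 3) (x : T3),
    Torus.partialDeriv i (Torus.partialDeriv j (fun y => c * f y)) x =
      c * Torus.partialDeriv i (Torus.partialDeriv j f) x := by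
  intro f hf c i j x
  rw [show Torus.partialDeriv j (fun y => c * f y) = fun y => c * Torus.partialDeriv j f y from
    funext fun y => torusJet_const_mul_deriv1 hf c j y]
  exact torusJet_const_mul_deriv1 (hf.partialDeriv j) c i x

/-- `∂ᵢ∂ⱼ(∑ₗ hₗ) = ∑ₗ ∂ᵢ∂ⱼhₗ`. [folklore] -/
theorem torusJet_sum_deriv2 : ∀ {ι : Type} (s : Finset ι) {h : ι → T3 → ℝ},
    (∀ l ∈ s, Torus.IsSmooth (h l)) → ∀ (i j : Fin 3) (x : T3),
    Torus.partialDeriv i (Torus.partialDeriv j (fun y => ∑ l ∈ s, h l y)) x =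
      ∑ l ∈ s, Torus.partialDeriv i (Torus.partialDeriv j (h l)) x := by
  intro ι s h hh i j x
  rw [show Torus.partialDeriv j (fun y => ∑ l ∈ s, h l y) = fun y => ∑ l ∈ s, Torus.partialDeriv j (h l) y
    from funext fun y => torusJet_sum_deriv1 s hh j y]
  exact torusJet_sum_deriv1 s (fun l hl => (hh l hl).partialDeriv j) i x

/-- **Leibniz rule, order 2**: `∂ᵢ∂ⱼ(f g) = ∂ᵢ∂ⱼf g + ∂ⱼf ∂ᵢg + ∂ᵢf ∂ⱼg + f ∂ᵢ∂ⱼg`. [folklore] -/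
theorem torusJet_mul_deriv2 : ∀ {f g : T3 → ℝ}, Torus.IsSmooth f → Torus.IsSmooth g →
    ∀ (i j : Fin 3) (x : T3),
    Torus.partialDeriv i (Torus.partialDeriv j (fun y => f y * g y)) x =
      Torus.partialDeriv i (Torus.partialDeriv j f) x * g x +
        Torus.partialDeriv j f x * Torus.partialDeriv i g x +
        Torus.partialDeriv i f x * Torus.partialDeriv j g x +
        f x * Torus.partialDeriv i (Torus.partialDeriv j g) x := by
  intro f g hf hg i j x
  rw [show Torus.partialDeriv j (fun y => f y * g y) =
      fun y => Torus.partialDeriv j f y * g y + f y * Torus.partialDeriv j g y from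
    funext fun y => torusJet_mul_deriv1 hf hg j y]
  exact torusJet_partialDeriv_eq_of_hasDerivAt
    (((torusJet_hasDerivAt_coordLine (hf.partialDeriv j) x i).fun_mul
      (torusJet_hasDerivAt_coordLine hg x i)).fun_add
    ((torusJet_hasDerivAt_coordLine hf x i).fun_mul
      (torusJet_hasDerivAt_coordLine (hg.partialDeriv j) x i)))
    (by simp only [zero_smul, Torus.proj_zero, add_zero] ; ring)

/-- **Chain rule, order 2** (prescribed derivatives `φ₁, φ₂` on `J ⊇ f(𝕋³)`):
`∂ᵢ∂ⱼ(φ ∘ f) = φ₂(f) ∂ᵢf ∂ⱼf + φ₁(f) ∂ᵢ∂ⱼf`. [folklore] -/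
theorem torusJet_comp_deriv2_of_hasDerivAt : ∀ {φ φ₁ φ₂ : ℝ → ℝ} {J : Set ℝ} {f : T3 → ℝ},
    Torus.IsSmooth f → (∀ y, f y ∈ J) → (∀ r ∈ J, HasDerivAt φ (φ₁ r) r) →
    (∀ r ∈ J, HasDerivAt φ₁ (φ₂ r) r) → ∀ (i j : Fin 3) (x : T3),
    Torus.partialDeriv i (Torus.partialDeriv j (fun y => φ (f y))) x =
      φ₂ (f x) * Torus.partialDeriv i f x * Torus.partialDeriv j f x +
        φ₁ (f x) * Torus.partialDeriv i (Torus.partialDeriv j f) x := by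
  intro φ φ₁ φ₂ J f hf hJ h1 h2 i j x
  rw [show Torus.partialDeriv j (fun y => φ (f y)) = fun y => φ₁ (f y) * Torus.partialDeriv j f y from
    funext fun y => torusJet_comp_deriv1_of_hasDerivAt hf hJ h1 j y]
  exact torusJet_partialDeriv_eq_of_hasDerivAt
    ((torusJet_hasDerivAt_coordLine_comp hf x i (h2 _ (hJ x))).fun_mul
      (torusJet_hasDerivAt_coordLine (hf.partialDeriv j) x i))
    (by simp only [zero_smul, Torus.proj_zero, add_zero])

/-- **Chain rule, order 2** (`φ` smooth on the open `J ⊇ f(𝕋³)`):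
`∂ᵢ∂ⱼ(φ ∘ f) = φ''(f) ∂ᵢf ∂ⱼf + φ'(f) ∂ᵢ∂ⱼf`, `φ'' = deriv (deriv φ)`. [folklore] -/
theorem torusJet_comp_deriv2 : ∀ {φ : ℝ → ℝ} {J : Set ℝ} {f : T3 → ℝ}, IsOpen J →
    ContDiffOn ℝ (⊤ : ℕ∞) φ J → Torus.IsSmooth f → (∀ y, f y ∈ J) → ∀ (i j : Fin 3) (x : T3),
    Torus.partialDeriv i (Torus.partialDeriv j (fun y => φ (f y))) x =
      deriv (deriv φ) (f x) * Torus.partialDeriv i f x * Torus.partialDeriv j f x +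
        deriv φ (f x) * Torus.partialDeriv i (Torus.partialDeriv j f) x :=
  fun hJ hφ hf hfJ i j x => torusJet_comp_deriv2_of_hasDerivAt hf hfJ
    (torusJet_hasDerivAt_of_contDiffOn hJ hφ)
    (torusJet_hasDerivAt_of_contDiffOn hJ (torusJet_contDiffOn_deriv hJ hφ)) i j x

/-- `∂ᵢ∂ⱼ(1/f) = 2 ∂ᵢf ∂ⱼf / f³ - ∂ᵢ∂ⱼf / f²` (`f ≠ 0`). [folklore] -/
theorem torusJet_inv_deriv2 : ∀ {f : T3 → ℝ}, Torus.IsSmooth f → (∀ y, f y ≠ 0) →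
    ∀ (i j : Fin 3) (x : T3),
    Torus.partialDeriv i (Torus.partialDeriv j (fun y => (f y)⁻¹)) x =
      2 * Torus.partialDeriv i f x * Torus.partialDeriv j f x / f x ^ 3 -
        Torus.partialDeriv i (Torus.partialDeriv j f) x / f x ^ 2 := by
  intro f hf h0 i j x
  rw [torusJet_comp_deriv2_of_hasDerivAt (φ := fun r => r⁻¹) (φ₁ := fun r => -(r ^ 2)⁻¹)
    (φ₂ := fun r => 2 * (r ^ 3)⁻¹) (J := {r | r ≠ 0}) hf h0 (fun r hr => hasDerivAt_inv hr)
    (fun r hr => torusJet_hasDerivAt_invJet2 hr) i j x]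
  ring

/-- `∂ᵢ∂ⱼ(f ^ p) = p (p-1) f^{p-2} ∂ᵢf ∂ⱼf + p f^{p-1} ∂ᵢ∂ⱼf` (`f > 0`). [folklore] -/
theorem torusJet_rpow_deriv2 : ∀ {f : T3 → ℝ}, Torus.IsSmooth f → (∀ y, 0 < f y) →
    ∀ (p : ℝ) (i j : Fin 3) (x : T3),
    Torus.partialDeriv i (Torus.partialDeriv j (fun y => f y ^ p)) x =
      p * (p - 1) * f x ^ (p - 2) * Torus.partialDeriv i f x * Torus.partialDeriv j f x +
        p * f x ^ (p - 1) * Torus.partialDeriv i (Torus.partialDeriv j f) x :=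
  fun hf hpos p i j x => torusJet_comp_deriv2_of_hasDerivAt (J := Ioi 0) hf hpos
    (fun _ hr => Real.hasDerivAt_rpow_const (Or.inl (ne_of_gt hr)))
    (fun _ hr => torusJet_hasDerivAt_rpowJet2 p hr) i j x

/-! ### Order 3 -/

/-- `∂ᵢ∂ⱼ∂ₖ c = 0`. [folklore] -/
theorem torusJet_const_deriv3 : ∀ (c : ℝ) (i j k : Fin 3) (x : T3),
    Torus.partialDeriv i (Torus.partialDeriv j (Torus.partialDeriv k (fun _ : T3 => c))) x = 0 := by
  intro c i j k x
  rw [show Torus.partialDeriv k (fun _ : T3 => c) = fun _ => (0 : ℝ) from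
    funext fun y => torusJet_const_deriv1 c k y]
  exact torusJet_const_deriv2 0 i j x

/-- `∂ᵢ∂ⱼ∂ₖ(f + g) = ∂ᵢ∂ⱼ∂ₖf + ∂ᵢ∂ⱼ∂ₖg`. [folklore] -/
theorem torusJet_add_deriv3 : ∀ {f g : T3 → ℝ}, Torus.IsSmooth f → Torus.IsSmooth g →
    ∀ (i j k : Fin 3) (x : T3),
    Torus.partialDeriv i (Torus.partialDeriv j (Torus.partialDeriv k (fun y => f y + g y))) x =
      Torus.partialDeriv i (Torus.partialDeriv j (Torus.partialDeriv k f)) x +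
        Torus.partialDeriv i (Torus.partialDeriv j (Torus.partialDeriv k g)) x := by
  intro f g hf hg i j k x
  rw [show Torus.partialDeriv k (fun y => f y + g y) =
      fun y => Torus.partialDeriv k f y + Torus.partialDeriv k g y from
    funext fun y => torusJet_add_deriv1 hf hg k y]
  exact torusJet_add_deriv2 (hf.partialDeriv k) (hg.partialDeriv k) i j x

/-- `∂ᵢ∂ⱼ∂ₖ(f - g) = ∂ᵢ∂ⱼ∂ₖf - ∂ᵢ∂ⱼ∂ₖg`. [folklore] -/
theorem torusJet_sub_deriv3 : ∀ {f g : T3 → ℝ}, Torus.IsSmooth f → Torus.IsSmooth g →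
    ∀ (i j k : Fin 3) (x : T3),
    Torus.partialDeriv i (Torus.partialDeriv j (Torus.partialDeriv k (fun y => f y - g y))) x =
      Torus.partialDeriv i (Torus.partialDeriv j (Torus.partialDeriv k f)) x -
        Torus.partialDeriv i (Torus.partialDeriv j (Torus.partialDeriv k g)) x := by
  intro f g hf hg i j k x
  rw [show Torus.partialDeriv k (fun y => f y - g y) =
      fun y => Torus.partialDeriv k f y - Torus.partialDeriv k g y from
    funext fun y => torusJet_sub_deriv1 hf hg k y]
  exact torusJet_sub_deriv2 (hf.partialDeriv k) (hg.partialDeriv k) i j x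

/-- `∂ᵢ∂ⱼ∂ₖ(-f) = -∂ᵢ∂ⱼ∂ₖf`. [folklore] -/
theorem torusJet_neg_deriv3 : ∀ {f : T3 → ℝ}, Torus.IsSmooth f → ∀ (i j k : Fin 3) (x : T3),
    Torus.partialDeriv i (Torus.partialDeriv j (Torus.partialDeriv k (fun y => -f y))) x =
      -Torus.partialDeriv i (Torus.partialDeriv j (Torus.partialDeriv k f)) x := by
  intro f hf i j k x
  rw [show Torus.partialDeriv k (fun y => -f y) = fun y => -Torus.partialDeriv k f y from
    funext fun y => torusJet_neg_deriv1 hf k y]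
  exact torusJet_neg_deriv2 (hf.partialDeriv k) i j x

/-- `∂ᵢ∂ⱼ∂ₖ(c f) = c ∂ᵢ∂ⱼ∂ₖf`. [folklore] -/
theorem torusJet_const_mul_deriv3 : ∀ {f : T3 → ℝ}, Torus.IsSmooth f →
    ∀ (c : ℝ) (i j k : Fin 3) (x : T3),
    Torus.partialDeriv i (Torus.partialDeriv j (Torus.partialDeriv k (fun y => c * f y))) x =
      c * Torus.partialDeriv i (Torus.partialDeriv j (Torus.partialDeriv k f)) x := by
  intro f hf c i j k x
  rw [show Torus.partialDeriv k (fun y => c * f y) = fun y => c * Torus.partialDeriv k f y from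
    funext fun y => torusJet_const_mul_deriv1 hf c k y]
  exact torusJet_const_mul_deriv2 (hf.partialDeriv k) c i j x

/-- `∂ᵢ∂ⱼ∂ₖ(∑ₗ hₗ) = ∑ₗ ∂ᵢ∂ⱼ∂ₖhₗ`. [folklore] -/
theorem torusJet_sum_deriv3 : ∀ {ι : Type} (s : Finset ι) {h : ι → T3 → ℝ},
    (∀ l ∈ s, Torus.IsSmooth (h l)) → ∀ (i j k : Fin 3) (x : T3),
    Torus.partialDeriv i (Torus.partialDeriv j (Torus.partialDeriv k (fun y => ∑ l ∈ s, h l y))) x =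
      ∑ l ∈ s, Torus.partialDeriv i (Torus.partialDeriv j (Torus.partialDeriv k (h l))) x := by
  intro ι s h hh i j k x
  rw [show Torus.partialDeriv k (fun y => ∑ l ∈ s, h l y) = fun y => ∑ l ∈ s, Torus.partialDeriv k (h l) y
    from funext fun y => torusJet_sum_deriv1 s hh k y]
  exact torusJet_sum_deriv2 s (fun l hl => (hh l hl).partialDeriv k) i j x

/-- **Leibniz rule, order 3** (8 terms):
`∂ᵢ∂ⱼ∂ₖ(f g) = ∂ᵢ∂ⱼ∂ₖf g + ∂ⱼ∂ₖf ∂ᵢg + ∂ᵢ∂ₖf ∂ⱼg + ∂ᵢ∂ⱼf ∂ₖg + ∂ₖf ∂ᵢ∂ⱼg + ∂ⱼf ∂ᵢ∂ₖg + ∂ᵢf ∂ⱼ∂ₖg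
+ f ∂ᵢ∂ⱼ∂ₖg`. [folklore] -/
theorem torusJet_mul_deriv3 : ∀ {f g : T3 → ℝ}, Torus.IsSmooth f → Torus.IsSmooth g →
    ∀ (i j k : Fin 3) (x : T3),
    Torus.partialDeriv i (Torus.partialDeriv j (Torus.partialDeriv k (fun y => f y * g y))) x =
      Torus.partialDeriv i (Torus.partialDeriv j (Torus.partialDeriv k f)) x * g x +
        Torus.partialDeriv j (Torus.partialDeriv k f) x * Torus.partialDeriv i g x +
        Torus.partialDeriv i (Torus.partialDeriv k f) x * Torus.partialDeriv j g x +
        Torus.partialDeriv i (Torus.partialDeriv j f) x * Torus.partialDeriv k g x +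
        Torus.partialDeriv k f x * Torus.partialDeriv i (Torus.partialDeriv j g) x +
        Torus.partialDeriv j f x * Torus.partialDeriv i (Torus.partialDeriv k g) x +
        Torus.partialDeriv i f x * Torus.partialDeriv j (Torus.partialDeriv k g) x +
        f x * Torus.partialDeriv i (Torus.partialDeriv j (Torus.partialDeriv k g)) x := by
  intro f g hf hg i j k x
  rw [show Torus.partialDeriv j (Torus.partialDeriv k (fun y => f y * g y)) =
      fun y => Torus.partialDeriv j (Torus.partialDeriv k f) y * g y +
        Torus.partialDeriv k f y * Torus.partialDeriv j g y +
        Torus.partialDeriv j f y * Torus.partialDeriv k g y +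
        f y * Torus.partialDeriv j (Torus.partialDeriv k g) y from
    funext fun y => torusJet_mul_deriv2 hf hg j k y]
  exact torusJet_partialDeriv_eq_of_hasDerivAt
    (((((torusJet_hasDerivAt_coordLine ((hf.partialDeriv k).partialDeriv j) x i).fun_mul
      (torusJet_hasDerivAt_coordLine hg x i)).fun_add
    ((torusJet_hasDerivAt_coordLine (hf.partialDeriv k) x i).fun_mul
      (torusJet_hasDerivAt_coordLine (hg.partialDeriv j) x i))).fun_add
    ((torusJet_hasDerivAt_coordLine (hf.partialDeriv j) x i).fun_mul
      (torusJet_hasDerivAt_coordLine (hg.partialDeriv k) x i))).fun_add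
    ((torusJet_hasDerivAt_coordLine hf x i).fun_mul
      (torusJet_hasDerivAt_coordLine ((hg.partialDeriv k).partialDeriv j) x i)))
    (by simp only [zero_smul, Torus.proj_zero, add_zero] ; ring)

/-- **Chain rule, order 3** (prescribed derivatives `φ₁, φ₂, φ₃` on `J ⊇ f(𝕋³)`):
`∂ᵢ∂ⱼ∂ₖ(φ ∘ f) = φ₃(f) ∂ᵢf ∂ⱼf ∂ₖf + φ₂(f) (∂ᵢ∂ⱼf ∂ₖf + ∂ᵢ∂ₖf ∂ⱼf + ∂ⱼ∂ₖf ∂ᵢf) + φ₁(f) ∂ᵢ∂ⱼ∂ₖf`.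
[folklore] -/
theorem torusJet_comp_deriv3_of_hasDerivAt : ∀ {φ φ₁ φ₂ φ₃ : ℝ → ℝ} {J : Set ℝ} {f : T3 → ℝ},
    Torus.IsSmooth f → (∀ y, f y ∈ J) → (∀ r ∈ J, HasDerivAt φ (φ₁ r) r) →
    (∀ r ∈ J, HasDerivAt φ₁ (φ₂ r) r) → (∀ r ∈ J, HasDerivAt φ₂ (φ₃ r) r) →
    ∀ (i j k : Fin 3) (x : T3),
    Torus.partialDeriv i (Torus.partialDeriv j (Torus.partialDeriv k (fun y => φ (f y)))) x =
      φ₃ (f x) * Torus.partialDeriv i f x * Torus.partialDeriv j f x * Torus.partialDeriv k f x +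
        φ₂ (f x) * (Torus.partialDeriv i (Torus.partialDeriv j f) x * Torus.partialDeriv k f x +
          Torus.partialDeriv i (Torus.partialDeriv k f) x * Torus.partialDeriv j f x +
          Torus.partialDeriv j (Torus.partialDeriv k f) x * Torus.partialDeriv i f x) +
        φ₁ (f x) * Torus.partialDeriv i (Torus.partialDeriv j (Torus.partialDeriv k f)) x := by
  intro φ φ₁ φ₂ φ₃ J f hf hJ h1 h2 h3 i j k x
  rw [show Torus.partialDeriv j (Torus.partialDeriv k (fun y => φ (f y))) =
      fun y => φ₂ (f y) * Torus.partialDeriv j f y * Torus.partialDeriv k f y +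
        φ₁ (f y) * Torus.partialDeriv j (Torus.partialDeriv k f) y from
    funext fun y => torusJet_comp_deriv2_of_hasDerivAt hf hJ h1 h2 j k y]
  exact torusJet_partialDeriv_eq_of_hasDerivAt
    ((((torusJet_hasDerivAt_coordLine_comp hf x i (h3 _ (hJ x))).fun_mul
      (torusJet_hasDerivAt_coordLine (hf.partialDeriv j) x i)).fun_mul
      (torusJet_hasDerivAt_coordLine (hf.partialDeriv k) x i)).fun_add
    ((torusJet_hasDerivAt_coordLine_comp hf x i (h2 _ (hJ x))).fun_mul
      (torusJet_hasDerivAt_coordLine ((hf.partialDeriv k).partialDeriv j) x i)))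
    (by simp only [zero_smul, Torus.proj_zero, add_zero] ; ring)

/-- **Chain rule, order 3** (`φ` smooth on the open `J ⊇ f(𝕋³)`), with `φ' = deriv φ`,
`φ'' = deriv (deriv φ)`, `φ''' = deriv (deriv (deriv φ))` evaluated at `f x`. [folklore] -/
theorem torusJet_comp_deriv3 : ∀ {φ : ℝ → ℝ} {J : Set ℝ} {f : T3 → ℝ}, IsOpen J →
    ContDiffOn ℝ (⊤ : ℕ∞) φ J → Torus.IsSmooth f → (∀ y, f y ∈ J) → ∀ (i j k : Fin 3) (x : T3),
    Torus.partialDeriv i (Torus.partialDeriv j (Torus.partialDeriv k (fun y => φ (f y)))) x =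
      deriv (deriv (deriv φ)) (f x) * Torus.partialDeriv i f x * Torus.partialDeriv j f x *
          Torus.partialDeriv k f x +
        deriv (deriv φ) (f x) * (Torus.partialDeriv i (Torus.partialDeriv j f) x * Torus.partialDeriv k f x +
          Torus.partialDeriv i (Torus.partialDeriv k f) x * Torus.partialDeriv j f x +
          Torus.partialDeriv j (Torus.partialDeriv k f) x * Torus.partialDeriv i f x) +
        deriv φ (f x) * Torus.partialDeriv i (Torus.partialDeriv j (Torus.partialDeriv k f)) x :=
  fun hJ hφ hf hfJ i j k x => torusJet_comp_deriv3_of_hasDerivAt hf hfJ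
    (torusJet_hasDerivAt_of_contDiffOn hJ hφ)
    (torusJet_hasDerivAt_of_contDiffOn hJ (torusJet_contDiffOn_deriv hJ hφ))
    (torusJet_hasDerivAt_of_contDiffOn hJ
      (torusJet_contDiffOn_deriv hJ (torusJet_contDiffOn_deriv hJ hφ))) i j k x

/-- `∂ᵢ∂ⱼ∂ₖ(1/f) = -6 ∂ᵢf ∂ⱼf ∂ₖf / f⁴ + 2 (∂ᵢ∂ⱼf ∂ₖf + ∂ᵢ∂ₖf ∂ⱼf + ∂ⱼ∂ₖf ∂ᵢf) / f³ - ∂ᵢ∂ⱼ∂ₖf / f²`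
(`f ≠ 0`). [folklore] -/
theorem torusJet_inv_deriv3 : ∀ {f : T3 → ℝ}, Torus.IsSmooth f → (∀ y, f y ≠ 0) →
    ∀ (i j k : Fin 3) (x : T3),
    Torus.partialDeriv i (Torus.partialDeriv j (Torus.partialDeriv k (fun y => (f y)⁻¹))) x =
      -(6 * Torus.partialDeriv i f x * Torus.partialDeriv j f x * Torus.partialDeriv k f x) / f x ^ 4 +
        2 * (Torus.partialDeriv i (Torus.partialDeriv j f) x * Torus.partialDeriv k f x +
          Torus.partialDeriv i (Torus.partialDeriv k f) x * Torus.partialDeriv j f x +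
          Torus.partialDeriv j (Torus.partialDeriv k f) x * Torus.partialDeriv i f x) / f x ^ 3 -
        Torus.partialDeriv i (Torus.partialDeriv j (Torus.partialDeriv k f)) x / f x ^ 2 := by
  intro f hf h0 i j k x
  rw [torusJet_comp_deriv3_of_hasDerivAt (φ := fun r => r⁻¹) (φ₁ := fun r => -(r ^ 2)⁻¹)
    (φ₂ := fun r => 2 * (r ^ 3)⁻¹) (φ₃ := fun r => -(6 * (r ^ 4)⁻¹)) (J := {r | r ≠ 0}) hf h0
    (fun r hr => hasDerivAt_inv hr) (fun r hr => torusJet_hasDerivAt_invJet2 hr)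
    (fun r hr => torusJet_hasDerivAt_invJet3 hr) i j k x]
  ring

/-- `∂ᵢ∂ⱼ∂ₖ(f ^ p)` for `f > 0`: Faà di Bruno with `φ' = p r^{p-1}`, `φ'' = p(p-1) r^{p-2}`,
`φ''' = p(p-1)(p-2) r^{p-3}`. [folklore] -/
theorem torusJet_rpow_deriv3 : ∀ {f : T3 → ℝ}, Torus.IsSmooth f → (∀ y, 0 < f y) →
    ∀ (p : ℝ) (i j k : Fin 3) (x : T3),
    Torus.partialDeriv i (Torus.partialDeriv j (Torus.partialDeriv k (fun y => f y ^ p))) x =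
      p * (p - 1) * (p - 2) * f x ^ (p - 3) * Torus.partialDeriv i f x * Torus.partialDeriv j f x *
          Torus.partialDeriv k f x +
        p * (p - 1) * f x ^ (p - 2) * (Torus.partialDeriv i (Torus.partialDeriv j f) x * Torus.partialDeriv k f x +
          Torus.partialDeriv i (Torus.partialDeriv k f) x * Torus.partialDeriv j f x +
          Torus.partialDeriv j (Torus.partialDeriv k f) x * Torus.partialDeriv i f x) +
        p * f x ^ (p - 1) * Torus.partialDeriv i (Torus.partialDeriv j (Torus.partialDeriv k f)) x :=
  fun hf hpos p i j k x => torusJet_comp_deriv3_of_hasDerivAt (J := Ioi 0) hf hpos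
    (fun _ hr => Real.hasDerivAt_rpow_const (Or.inl (ne_of_gt hr)))
    (fun _ hr => torusJet_hasDerivAt_rpowJet2 p hr) (fun _ hr => torusJet_hasDerivAt_rpowJet3 p hr) i j k x

end TorusJetIdentities

end Summit.AtomisticToContinuum.HydrodynamicLimit.Theorems

end
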